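import Summits.CriticalPhenomena.PercolationContinuityZ3.Theorems.SahiConjecture
import Literature.Combinatorics.Sahi2008.Indicators

/-!
# Kahn's Conjecture 5 (events) ⟺ order-3 Sahi positivity of every product weight (functions)

Companion of `SahiConjecture.lean` (cell `prim-sahi`, typer; `--supports stmt-CriticalPhenomena-4575`).  By the finite
layer cake (`Literature.Combinatorics.Sahi2008.sahiPositive_iff_indicators`, [LiebSahi2021, Lemma 2.2] in discrete
form) the events form of the `n = 3` question for product measures [Kahn2022, Conj. 5] — the obligation
`KahnConjecture` — is EQUIVALENT to `SahiPositive (bernoulliWeight p) 3` for every finite `ι : Type` and every `p`,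
i.e. to Sahi's `C_3` restricted to product measures in its FUNCTION form.  Proved here; nothing is asserted about
either conjecture.
-/

noncomputable section

namespace Summit.CriticalPhenomena.PercolationContinuityZ3.Theorems

open MeasureTheory
open Literature.Combinatorics.Sahi2008
open Literature.Probability.LatticeModels (prodBernoulli sahiE3)
open Literature.Probability.Percolation
open Literature.Probability.Percolation.DecisionTree (ind)

/-- Kahn's events form is the whole of order-`3` Sahi positivity of every product weight (layer cake:
`Literature.Combinatorics.Sahi2008.sahiPositive_iff_indicators`). [cite: Kahn2022, Conj. 5 (arXiv p. 3); LiebSahi2021, Lemma 2.2] -/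
theorem kahnConjecture_iff_sahiPositive :
    KahnConjecture ↔ ∀ (ι : Type) [Fintype ι] (p : ι → unitInterval), SahiPositive (bernoulliWeight p) 3 := by
  classical
  constructor
  · intro hK ι _ p
    rw [sahiPositive_iff_indicators]
    intro U hU
    have hind : (fun i => setInd (U i)) =
        ![ind (U 0 : Set (Set ι)), ind (U 1 : Set (Set ι)), ind (U 2 : Set (Set ι))] := by
      funext i ω
      fin_cases i <;> simp [setInd_apply, ind]
    rw [hind, sahiE_three_ind]
    exact hK ι p _ _ _ (fun a b hab ha => hU 0 hab ha) (fun a b hab ha => hU 1 hab ha)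
      (fun a b hab ha => hU 2 hab ha)
  · intro h ι _ p A B C hA hB hC
    exact sahiE3_nonneg_of_sahiPositive_upper p (h ι p) hA hB hC

end Summit.CriticalPhenomena.PercolationContinuityZ3.Theorems
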